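import Mathlib
import HarnessLib
import Summits.Ventures.LatticeQCDFlow.Exactness.MatrixExpChart

/-!
# The exponential chart of `SU(N)` in linear coordinates of `𝔰𝔲(N)`: a local inverse, and the Lipschitz transport of left multiplication

HONEST FRAMING: exact (Metropolis-corrected) sampling algorithms for lattice gauge theory;
figures of merit are autocorrelation/cost numbers at stated couplings and volumes; no
continuum-physics claim.

Venture `LatticeQCDFlow` (cell pub-lqcd), topic `Exactness`, FANOUT row 9 (eng-latcore, the
engine `latflow.core`: the `SU(N)` link Metropolis `U ← exp(X) U` and the HMC drift
`U ← exp(εP) U`, whose algebra elements `X`, `P` the code draws through real coordinates).  NEW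
WORK of the cell over Mathlib (`ContDiffAt.exists_lipschitzOnWith`: a `C¹` map is Lipschitz near
the point; `ContDiff.mul`) and the tree (`MatrixExpChart.lean`: `matrixLog`, `logChartSet`,
`matrixLog_mem_skewTraceless`); nothing here is cited as a fact.  Printed counterpart, NAMED ONLY:
Hall, *Lie Groups, Lie Algebras, and Representations* (2015) Cor. 3.45 (the exponential is a local
chart of a matrix Lie group).

THE SETTING.  `E` is any finite-dimensional real normed space and `ι : E →ₗ[ℝ] M_n(ℂ)` an injective
linear map whose range is exactly the skew-Hermitian traceless matrices (`𝔰𝔲(N)` in coordinates —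
the engine's coordinates are one instance).  Hypotheses are carried explicitly: `hι` (values
skew-Hermitian and traceless), `hinj` (injective), `hsurj` (every skew-Hermitian traceless matrix is
a value).

* §1 `coordOf ι hinj` — a linear left inverse of `ι`; `suExp ι hι a = exp (ι a) ∈ SU(N)`
  (continuous, `suExp 0 = 1`, `suExp (−a) = (suExp a)⁻¹`); `suLog ι hinj U = coordOf (log U)`;
  `suChartSet` — the open neighbourhood of `1` in `SU(N)` lying over `logChartSet`; **`ι_suLog`**,
  **`suExp_suLog`** (on `suChartSet`: `log U ∈ range ι` and `exp log U = U`), **`suLog_suExp`** (on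
  `ι⁻¹ source`), `suLog_one`, `continuousOn_suLog`; `logBall B = suChartSet ∩ suLog⁻¹ B`.
* §2 `mulLog (x, a) = suLog (suExp x · suExp a)` — left multiplication read in the chart;
  **`contDiffAt_mulLog_zero`** (`C¹` at `(0,0)`: `coordOf ∘ matrixLog ∘ mul ∘ (exp ι × exp ι)`);
  **`exists_goodRadius`** — a Lipschitz constant `K` and `R₀ > 0` such that for all `R ≤ R₀`:
  `mulLog` is `K`-Lipschitz on `B̄((0,0), R)`, products `suExp x · suExp a` with `x, a ∈ B̄(0,R)`
  stay in `suChartSet`, and `ι B̄(0,R) ⊆ source`.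
* §3 THE TWO CONTAINMENTS, for such `K, R` and `x ∈ B̄(0,R/2)`, `0 < ρ ≤ R/2`:
  **`image_mul_logBall_subset`** — `suExp x · logBall B̄(0,ρ) ⊆ logBall B̄(x, Kρ)`;
  **`logBall_subset_image_mul`** — `logBall B̄(x,ρ) ⊆ suExp x · logBall B̄(0, Kρ)`.
  Left invariance of Haar measure turns these into the two ball inequalities of
  `LocalBallComparison.lean`.

NOT CLAIMED: any estimate of `K` or `R₀` (inverse function theorem); smoothness of the chart beyond
`C¹` at the identity; anything measure-theoretic.
-/

noncomputable section

namespace Summit.Ventures.LatticeQCDFlow.Exactness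

open NormedSpace Set Filter Topology Metric Function
open scoped Matrix Matrix.Norms.Operator NNReal

set_option backward.isDefEq.respectTransparency false

variable {n : Type*} {E : Type*} [NormedAddCommGroup E] [NormedSpace ℝ E]

/-! ## §1 The chart maps -/

section Coords

/-- A linear left inverse of an injective linear map `ι` ("read the coordinates"). -/
def coordOf (ι : E →ₗ[ℝ] Matrix n n ℂ) (hinj : Injective ι) : Matrix n n ℂ →ₗ[ℝ] E :=
  Classical.choose (ι.exists_leftInverse_of_injective (LinearMap.ker_eq_bot.2 hinj))

/-- `coordOf ∘ ι = id`. -/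
theorem coordOf_comp (ι : E →ₗ[ℝ] Matrix n n ℂ) (hinj : Injective ι) : (coordOf ι hinj) ∘ₗ ι = LinearMap.id :=
  Classical.choose_spec (ι.exists_leftInverse_of_injective (LinearMap.ker_eq_bot.2 hinj))

/-- `coordOf (ι a) = a`. -/
@[simp] theorem coordOf_apply (ι : E →ₗ[ℝ] Matrix n n ℂ) (hinj : Injective ι) (a : E) : coordOf ι hinj (ι a) = a := by
  have h := LinearMap.congr_fun (coordOf_comp ι hinj) a
  simpa using h

/-- `ι` is continuous (finite-dimensional domain). -/
theorem continuous_coords [FiniteDimensional ℝ E] (ι : E →ₗ[ℝ] Matrix n n ℂ) : Continuous ι :=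
  ι.continuous_of_finiteDimensional

variable [Fintype n]

/-- `coordOf` is continuous (finite-dimensional domain `M_n(ℂ)`). -/
theorem continuous_coordOf (ι : E →ₗ[ℝ] Matrix n n ℂ) (hinj : Injective ι) : Continuous (coordOf ι hinj) :=
  (coordOf ι hinj).continuous_of_finiteDimensional

end Coords

section Chart

variable [Fintype n] [DecidableEq n] (ι : E →ₗ[ℝ] Matrix n n ℂ) (hι : ∀ a, (ι a)ᴴ = -ι a ∧ (ι a).trace = 0)

/-- **`suExp a = exp (ι a) ∈ SU(N)`** — the exponential through the coordinates. -/
def suExp (a : E) : Matrix.specialUnitaryGroup n ℂ :=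
  ⟨exp (ι a), exp_mem_specialUnitaryGroup_of_skew (hι a).1 (hι a).2⟩

/-- Underlying matrix. -/
@[simp] theorem coe_suExp (a : E) : ((suExp ι hι a : Matrix.specialUnitaryGroup n ℂ) : Matrix n n ℂ) = exp (ι a) := rfl

/-- `suExp` is continuous. -/
theorem continuous_suExp [FiniteDimensional ℝ E] : Continuous (suExp ι hι) :=
  Continuous.subtype_mk (exp_continuous.comp (continuous_coords ι)) _

/-- `suExp 0 = 1`. -/
theorem suExp_zero : suExp ι hι 0 = 1 := Subtype.ext (by simp [exp_zero])

/-- `suExp (−a) = (suExp a)⁻¹`. -/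
theorem suExp_neg (a : E) : suExp ι hι (-a) = (suExp ι hι a)⁻¹ := by
  refine eq_inv_of_mul_eq_one_left (Subtype.ext ?_)
  change exp (ι (-a)) * exp (ι a) = 1
  rw [map_neg, ← exp_add_of_commute (Commute.neg_left (Commute.refl (ι a))), neg_add_cancel, exp_zero]

/-- `suExp x · suExp (−x) = 1`. -/
theorem suExp_mul_suExp_neg (x : E) : suExp ι hι x * suExp ι hι (-x) = 1 := by
  rw [suExp_neg, mul_inv_cancel]

/-- `suExp (−x) · suExp x = 1`. -/
theorem suExp_neg_mul_suExp (x : E) : suExp ι hι (-x) * suExp ι hι x = 1 := by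
  rw [suExp_neg, inv_mul_cancel]

/-- The chart neighbourhood of `1` in `SU(N)`: the elements lying over `logChartSet`. -/
def suChartSet : Set (Matrix.specialUnitaryGroup n ℂ) := {U | (U : Matrix n n ℂ) ∈ logChartSet (n := n)}

/-- `suChartSet` is open. -/
theorem isOpen_suChartSet : IsOpen (suChartSet (n := n)) := isOpen_logChartSet.preimage continuous_subtype_val

/-- `1 ∈ suChartSet`. -/
theorem one_mem_suChartSet : (1 : Matrix.specialUnitaryGroup n ℂ) ∈ suChartSet (n := n) := by
  change (1 : Matrix n n ℂ) ∈ logChartSet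
  exact one_mem_logChartSet

variable (hinj : Injective ι)

/-- **`suLog U = coordOf (log U)`** — the logarithm read in coordinates (a total function, meaningful
on `suChartSet`). -/
def suLog (U : Matrix.specialUnitaryGroup n ℂ) : E := coordOf ι hinj (matrixLog (U : Matrix n n ℂ))

/-- **On `suChartSet` the logarithm lies in the range of the coordinates**: `ι (suLog U) = log U`. -/
theorem ι_suLog (hsurj : ∀ X : Matrix n n ℂ, Xᴴ = -X → X.trace = 0 → X ∈ LinearMap.range ι)
    {U : Matrix.specialUnitaryGroup n ℂ} (hU : U ∈ suChartSet (n := n)) :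
    ι (suLog ι hinj U) = matrixLog (U : Matrix n n ℂ) := by
  obtain ⟨hskew, htr⟩ := matrixLog_mem_skewTraceless hU
  obtain ⟨a, ha⟩ := hsurj _ hskew htr
  rw [suLog, ← ha, coordOf_apply]

/-- **`suExp (suLog U) = U` on `suChartSet`.** -/
theorem suExp_suLog (hsurj : ∀ X : Matrix n n ℂ, Xᴴ = -X → X.trace = 0 → X ∈ LinearMap.range ι)
    {U : Matrix.specialUnitaryGroup n ℂ} (hU : U ∈ suChartSet (n := n)) :
    suExp ι hι (suLog ι hinj U) = U :=
  Subtype.ext (by rw [coe_suExp, ι_suLog ι hinj hsurj hU, exp_matrixLog_coe hU])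

/-- **`suLog (suExp a) = a` whenever `ι a` is in the source of the chart.** -/
theorem suLog_suExp {a : E} (ha : ι a ∈ (matrixExpChart (n := n)).source) : suLog ι hinj (suExp ι hι a) = a := by
  rw [suLog, coe_suExp, matrixLog_exp ha, coordOf_apply]

/-- `suLog 1 = 0`. -/
theorem suLog_one : suLog ι hinj (1 : Matrix.specialUnitaryGroup n ℂ) = 0 := by
  change coordOf ι hinj (matrixLog (1 : Matrix n n ℂ)) = 0
  rw [matrixLog_one, map_zero]

/-- `suLog` is continuous on `suChartSet`. -/
theorem continuousOn_suLog : ContinuousOn (suLog ι hinj) (suChartSet (n := n)) :=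
  (continuous_coordOf ι hinj).comp_continuousOn
    (continuousOn_matrixLog.comp continuous_subtype_val.continuousOn fun _ hU => logChartSet_subset_target hU)

/-- The elements of the chart neighbourhood whose logarithm (in coordinates) lies in `B`. -/
def logBall (B : Set E) : Set (Matrix.specialUnitaryGroup n ℂ) := suChartSet (n := n) ∩ suLog ι hinj ⁻¹' B

/-- Membership in `logBall`. -/
theorem mem_logBall {B : Set E} {U : Matrix.specialUnitaryGroup n ℂ} :
    U ∈ logBall ι hinj B ↔ U ∈ suChartSet (n := n) ∧ suLog ι hinj U ∈ B := Iff.rfl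

/-! ## §2 Left multiplication read in the chart is `C¹`, hence Lipschitz near the origin -/

/-- The product of two exponentials as a matrix: `(x, a) ↦ exp (ι x) · exp (ι a)`. -/
def mulExp (p : E × E) : Matrix n n ℂ := exp (ι p.1) * exp (ι p.2)

/-- `mulExp` is smooth. -/
theorem contDiff_mulExp [FiniteDimensional ℝ E] : ContDiff ℝ ⊤ (mulExp (n := n) ι) := by
  have hexp : ContDiff ℝ ⊤ (exp : Matrix n n ℂ → Matrix n n ℂ) := contDiff_iff_contDiffAt.2 fun X => contDiffAt_matrixExp X
  have hl : ContDiff ℝ ⊤ (ι : E → Matrix n n ℂ) := (LinearMap.toContinuousLinearMap ι).contDiff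
  exact ((hexp.comp hl).comp contDiff_fst).mul ((hexp.comp hl).comp contDiff_snd)

/-- `mulExp (0,0) = 1`. -/
theorem mulExp_zero : mulExp (n := n) ι 0 = 1 := by
  simp [mulExp, exp_zero]

/-- **Left multiplication read in the chart**: `mulLog (x, a) = suLog (suExp x · suExp a)`. -/
def mulLog (p : E × E) : E := suLog ι hinj (suExp ι hι p.1 * suExp ι hι p.2)

/-- `mulLog = coordOf ∘ matrixLog ∘ mulExp`. -/
theorem mulLog_eq : mulLog ι hι hinj = fun p => coordOf ι hinj (matrixLog (mulExp ι p)) := rfl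

/-- **`mulLog` is `C¹` at the origin.** -/
theorem contDiffAt_mulLog_zero [FiniteDimensional ℝ E] : ContDiffAt ℝ 1 (mulLog (n := n) ι hι hinj) 0 := by
  rw [mulLog_eq]
  have hlog : ContDiffAt ℝ 1 (matrixLog (n := n)) (mulExp ι (0 : E × E)) := by
    rw [mulExp_zero]; exact contDiffAt_matrixLog_one
  have hm : ContDiffAt ℝ 1 (mulExp (n := n) ι) 0 := (contDiff_mulExp ι).contDiffAt.of_le le_top
  exact ((LinearMap.toContinuousLinearMap (coordOf ι hinj)).contDiff.contDiffAt).comp 0 (hlog.comp 0 hm)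

/-- **THE GOOD RADIUS.**  There are `K` and `R₀ > 0` such that for every `R ≤ R₀`: `mulLog` is
`K`-Lipschitz on the closed ball `B̄((0,0), R)` of `E × E`; every product `suExp x · suExp a` with
`x, a ∈ B̄(0, R)` lies in `suChartSet`; and `ι B̄(0,R) ⊆ source`. -/
theorem exists_goodRadius [FiniteDimensional ℝ E] : ∃ K : ℝ≥0, ∃ R₀ : ℝ, 0 < R₀ ∧ ∀ R : ℝ, R ≤ R₀ →
    LipschitzOnWith K (mulLog ι hι hinj) (closedBall (0 : E × E) R) ∧
    (∀ x ∈ closedBall (0 : E) R, ∀ a ∈ closedBall (0 : E) R, suExp ι hι x * suExp ι hι a ∈ suChartSet (n := n)) ∧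
    (∀ x ∈ closedBall (0 : E) R, ι x ∈ (matrixExpChart (n := n)).source) := by
  obtain ⟨K, t, ht, hK⟩ := (contDiffAt_mulLog_zero ι hι hinj).exists_lipschitzOnWith
  obtain ⟨ε₁, hε₁, hball₁⟩ := Metric.mem_nhds_iff.1 ht
  have h2 : (mulExp (n := n) ι) ⁻¹' logChartSet ∈ 𝓝 (0 : E × E) :=
    (contDiff_mulExp ι).continuous.continuousAt.preimage_mem_nhds
      (by rw [mulExp_zero]; exact isOpen_logChartSet.mem_nhds one_mem_logChartSet)
  obtain ⟨ε₂, hε₂, hball₂⟩ := Metric.mem_nhds_iff.1 h2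
  have h3 : (ι : E → Matrix n n ℂ) ⁻¹' (matrixExpChart (n := n)).source ∈ 𝓝 (0 : E) :=
    (continuous_coords ι).continuousAt.preimage_mem_nhds
      (by rw [map_zero]; exact isOpen_matrixExpChart_source.mem_nhds zero_mem_matrixExpChart_source)
  obtain ⟨ε₃, hε₃, hball₃⟩ := Metric.mem_nhds_iff.1 h3
  have hεpos : 0 < min (min ε₁ ε₂) ε₃ := lt_min (lt_min hε₁ hε₂) hε₃
  refine ⟨K, min (min ε₁ ε₂) ε₃ / 2, by positivity, fun R hR => ⟨?_, ?_, ?_⟩⟩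
  · refine hK.mono ((closedBall_subset_ball ?_).trans hball₁)
    calc R ≤ min (min ε₁ ε₂) ε₃ / 2 := hR
      _ < min (min ε₁ ε₂) ε₃ := by linarith
      _ ≤ ε₁ := (min_le_left _ _).trans (min_le_left _ _)
  · intro x hx a ha
    have hR2 : R < ε₂ := by
      calc R ≤ min (min ε₁ ε₂) ε₃ / 2 := hR
        _ < min (min ε₁ ε₂) ε₃ := by linarith
        _ ≤ ε₂ := (min_le_left _ _).trans (min_le_right _ _)
    have hxa : (x, a) ∈ ball (0 : E × E) ε₂ := by
      rw [mem_ball_zero_iff, Prod.norm_def, max_lt_iff]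
      rw [mem_closedBall_zero_iff] at hx ha
      exact ⟨by linarith, by linarith⟩
    exact hball₂ hxa
  · intro x hx
    have hx' : x ∈ ball (0 : E) ε₃ := by
      rw [mem_ball_zero_iff]; rw [mem_closedBall_zero_iff] at hx
      calc ‖x‖ ≤ R := hx
        _ ≤ min (min ε₁ ε₂) ε₃ / 2 := hR
        _ < min (min ε₁ ε₂) ε₃ := by linarith
        _ ≤ ε₃ := min_le_right _ _
    exact hball₃ hx'

/-! ## §3 The two containments -/

/-- The Lipschitz estimate along the second variable: for `x, a, b ∈ B̄(0,R)`,
`dist (mulLog (x,a)) (mulLog (x,b)) ≤ K · dist a b`. -/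
theorem dist_mulLog_le {K : ℝ≥0} {R : ℝ} (hK : LipschitzOnWith K (mulLog ι hι hinj) (closedBall (0 : E × E) R))
    {x a b : E} (hx : x ∈ closedBall (0 : E) R) (ha : a ∈ closedBall (0 : E) R) (hb : b ∈ closedBall (0 : E) R) :
    dist (mulLog ι hι hinj (x, a)) (mulLog ι hι hinj (x, b)) ≤ K * dist a b := by
  have hxa : (x, a) ∈ closedBall (0 : E × E) R := by
    rw [← closedBall_prod_same]; exact ⟨hx, ha⟩
  have hxb : (x, b) ∈ closedBall (0 : E × E) R := by
    rw [← closedBall_prod_same]; exact ⟨hx, hb⟩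
  have h := hK.dist_le_mul (x, a) hxa (x, b) hxb
  rwa [Prod.dist_eq, dist_self, max_eq_right dist_nonneg] at h

/-- `mulLog (x, 0) = x` when `ι x ∈ source`. -/
theorem mulLog_zero_right {x : E} (hx : ι x ∈ (matrixExpChart (n := n)).source) : mulLog ι hι hinj (x, 0) = x := by
  change suLog ι hinj (suExp ι hι x * suExp ι hι 0) = x
  rw [suExp_zero, mul_one, suLog_suExp ι hι hinj hx]

/-- `mulLog (−x, x) = 0`. -/
theorem mulLog_neg_left (x : E) : mulLog ι hι hinj (-x, x) = 0 := by
  change suLog ι hinj (suExp ι hι (-x) * suExp ι hι x) = 0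
  rw [suExp_neg_mul_suExp, suLog_one]

/-- **FIRST CONTAINMENT**: `suExp x · logBall B̄(0,ρ) ⊆ logBall B̄(x, Kρ)` for `x ∈ B̄(0,R/2)` and
`0 < ρ ≤ R/2` — multiplying an element with small logarithm by `suExp x` gives an element whose
logarithm is within `Kρ` of `x`. -/
theorem image_mul_logBall_subset (hsurj : ∀ X : Matrix n n ℂ, Xᴴ = -X → X.trace = 0 → X ∈ LinearMap.range ι)
    {K : ℝ≥0} {R : ℝ} (hK : LipschitzOnWith K (mulLog ι hι hinj) (closedBall (0 : E × E) R))
    (hprod : ∀ x ∈ closedBall (0 : E) R, ∀ a ∈ closedBall (0 : E) R, suExp ι hι x * suExp ι hι a ∈ suChartSet (n := n))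
    (hsrc : ∀ x ∈ closedBall (0 : E) R, ι x ∈ (matrixExpChart (n := n)).source)
    {x : E} (hx : x ∈ closedBall (0 : E) (R / 2)) {ρ : ℝ} (hρR : ρ ≤ R / 2) :
    (fun U => suExp ι hι x * U) '' logBall ι hinj (closedBall (0 : E) ρ) ⊆
      logBall ι hinj (closedBall x ((K : ℝ) * ρ)) := by
  have hR : 0 ≤ R := by linarith [norm_nonneg x, mem_closedBall_zero_iff.1 hx]
  have hxR : x ∈ closedBall (0 : E) R := closedBall_subset_closedBall (by linarith) hx
  rintro _ ⟨u, hu, rfl⟩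
  obtain ⟨huS, hua⟩ := (mem_logBall ι hinj).1 hu
  have haR : suLog ι hinj u ∈ closedBall (0 : E) R := closedBall_subset_closedBall (by linarith) hua
  have hu_eq : suExp ι hι (suLog ι hinj u) = u := suExp_suLog ι hι hinj hsurj huS
  refine (mem_logBall ι hinj).2 ⟨?_, ?_⟩
  · rw [← hu_eq]; exact hprod x hxR _ haR
  · have hval : suLog ι hinj (suExp ι hι x * u) = mulLog ι hι hinj (x, suLog ι hinj u) := by
      change suLog ι hinj (suExp ι hι x * u) = suLog ι hinj (suExp ι hι x * suExp ι hι (suLog ι hinj u))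
      rw [hu_eq]
    rw [hval, mem_closedBall]
    calc dist (mulLog ι hι hinj (x, suLog ι hinj u)) x
        = dist (mulLog ι hι hinj (x, suLog ι hinj u)) (mulLog ι hι hinj (x, 0)) := by
          rw [mulLog_zero_right ι hι hinj (hsrc x hxR)]
      _ ≤ K * dist (suLog ι hinj u) 0 := dist_mulLog_le ι hι hinj hK hxR haR (mem_closedBall_self hR)
      _ ≤ K * ρ := by
          rw [dist_zero_right]; exact mul_le_mul_of_nonneg_left (mem_closedBall_zero_iff.1 hua) K.2

/-- **SECOND CONTAINMENT**: `logBall B̄(x,ρ) ⊆ suExp x · logBall B̄(0, Kρ)` for `x ∈ B̄(0,R/2)` and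
`0 < ρ ≤ R/2` — an element whose logarithm is within `ρ` of `x` is `suExp x` times an element whose
logarithm is within `Kρ` of `0`. -/
theorem logBall_subset_image_mul (hsurj : ∀ X : Matrix n n ℂ, Xᴴ = -X → X.trace = 0 → X ∈ LinearMap.range ι)
    {K : ℝ≥0} {R : ℝ} (hK : LipschitzOnWith K (mulLog ι hι hinj) (closedBall (0 : E × E) R))
    (hprod : ∀ x ∈ closedBall (0 : E) R, ∀ a ∈ closedBall (0 : E) R, suExp ι hι x * suExp ι hι a ∈ suChartSet (n := n))
    {x : E} (hx : x ∈ closedBall (0 : E) (R / 2)) {ρ : ℝ} (hρR : ρ ≤ R / 2) :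
    logBall ι hinj (closedBall x ρ) ⊆
      (fun U => suExp ι hι x * U) '' logBall ι hinj (closedBall (0 : E) ((K : ℝ) * ρ)) := by
  have hxR : x ∈ closedBall (0 : E) R := closedBall_subset_closedBall (by
    linarith [norm_nonneg x, mem_closedBall_zero_iff.1 hx]) hx
  have hnxR : -x ∈ closedBall (0 : E) R := by
    rw [mem_closedBall_zero_iff, norm_neg]; exact mem_closedBall_zero_iff.1 hxR
  intro U hU
  obtain ⟨hUS, hUy⟩ := (mem_logBall ι hinj).1 hU
  have hyR : suLog ι hinj U ∈ closedBall (0 : E) R := by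
    rw [mem_closedBall_zero_iff]
    have h1 : dist (suLog ι hinj U) x ≤ ρ := mem_closedBall.1 hUy
    have h2 : ‖x‖ ≤ R / 2 := mem_closedBall_zero_iff.1 hx
    calc ‖suLog ι hinj U‖ = dist (suLog ι hinj U) 0 := (dist_zero_right _).symm
      _ ≤ dist (suLog ι hinj U) x + dist x 0 := dist_triangle _ _ _
      _ ≤ R := by rw [dist_zero_right]; linarith
  have hU_eq : suExp ι hι (suLog ι hinj U) = U := suExp_suLog ι hι hinj hsurj hUS
  refine ⟨suExp ι hι (-x) * U, (mem_logBall ι hinj).2 ⟨?_, ?_⟩, ?_⟩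
  · rw [← hU_eq]; exact hprod (-x) hnxR _ hyR
  · have hval : suLog ι hinj (suExp ι hι (-x) * U) = mulLog ι hι hinj (-x, suLog ι hinj U) := by
      change suLog ι hinj (suExp ι hι (-x) * U) = suLog ι hinj (suExp ι hι (-x) * suExp ι hι (suLog ι hinj U))
      rw [hU_eq]
    rw [hval, mem_closedBall, dist_zero_right]
    calc ‖mulLog ι hι hinj (-x, suLog ι hinj U)‖
        = dist (mulLog ι hι hinj (-x, suLog ι hinj U)) (mulLog ι hι hinj (-x, x)) := by
          rw [mulLog_neg_left, dist_zero_right]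
      _ ≤ K * dist (suLog ι hinj U) x := dist_mulLog_le ι hι hinj hK hnxR hyR hxR
      _ ≤ K * ρ := mul_le_mul_of_nonneg_left (mem_closedBall.1 hUy) K.2
  · change suExp ι hι x * (suExp ι hι (-x) * U) = U
    rw [← mul_assoc, suExp_mul_suExp_neg, one_mul]

end Chart

end Summit.Ventures.LatticeQCDFlow.Exactness
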